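import Summits.QuantumFields.YangMills.Theorems.AllWindowsColdBoxBoxHighLineFPRepresentation
import Summits.QuantumFields.YangMills.Theorems.AllWindowsColdBoxBoxHighLineSmallFieldInsideFPCore
import Summits.QuantumFields.YangMills.Theorems.AllWindowsColdBoxBoxHighLineSmallFieldSmallPlaquettes
import Summits.QuantumFields.YangMills.Theorems.WeakCouplingRatesColdBoxPlaqChart

/-!
# T-S5.13A «box → FP-chart small-field reduction», core (Steps A+B+C of ASSEMBLY-S5 per observable): box expectations versus the
# Faddeev–Popov chart weight on the small-field set (LEAD sfw-p2 g77's consumption list, 2026-08-29T20:23:50Z; LINE-19 S5 ⟨stmt-QuantumFields-24004⟩/⟨24335⟩)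

Width seat `ym-line-sfw-p2-w2` (g31).  For the cold-box state `boxState β H` and the FP-chart weight `w_J = fpChartWeight β H r` on `D = smallField H s`,
this CORE file proves, for every gauge-invariant measurable `0 ≤ G ≤ 1`,

  `|E_box G − ⟨G⟩_D| ≤ 4δ + 4·P_box(¬SP) + 2τ`,   `⟨G⟩_D := ∫_D G(U(a)) w_J(a) da / ∫_D w_J`

(the two-plaquette covariance bound `≤ 200(δ + p + τ)` is the companion file `…BoxToChartReduction`),

given (i)/(ii) of ✓T-S5.5J `fpRepresentation` VERBATIM (Landau representative of radius `r₀` on `ColdWall ∩ SP`, orbit normaliser `Z₀(1 ± δ)`),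
the small-field parameters of ✓LEMMA 6s `smallFieldSmallPlaquettes` (`0 ≤ s ≤ 1/100`, `17s² ≤ spl²`, so `1_SP ∘ edgeChart = 1` on `D`) and the
conclusion of ✓T-S5.6 `SmallFieldInsideFP` as a hypothesis `∫_{chartDomain ∖ D} w_J ≤ τ·∫_{smallField(s/2)} w_J` (dischargeable by
✓`SmallFieldFP.smallFieldInsideFP_of actionSandwich h6b`).

* Step A = ✓`fpRepresentation` (`|E_box G − E_box[G h_J 1_SP]/E_box[h_J 1_SP]| ≤ 4δ + 4p`, `0 ≤ G ≤ 1` gauge invariant);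
* Step B `boxState_ratio_eq_chart_ratio`: ✓T-S5.14 `boxStateEdgeChart` on numerator and denominator (the chart normaliser is `> 0` and cancels),
  with `fpChartWeight_eq_jacWeight_mul` (`w_J(a) = h_J(U a)·e^{−βS(U a)}·Πσ(a)`);
* Step C `abs_chart_ratio_sub_smallField_ratio_le` (`≤ 2τ`): split `chartDomain = D ∪ (chartDomain ∖ D)`, `W = w_J` on `D`, `0 ≤ W ≤ w_J` off `D`,
  and the elementary `ratio_le`;
* `abs_boxState_sub_smallField_ratio_le` (`≤ 4δ + 4p + 2τ` per observable) and the covariance algebra `cov_arith` (`48η ≤ 200(δ+p+τ)`) for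
  `c₀/4`, `c_T/4`, `c₀c_T/16` (✓`plaqCostAt_nonneg`, ✓`abs_plaqCostAt_le`, ✓`plaqCostAt_gaugeTransformZd`, ✓`measurable_plaqCostAt`).

Everything proved, tree + Mathlib; no definitions; standard axioms.
HONEST LABEL: measure plumbing for the T-S5.13 assembly of the XL stub S5 (`stub_landauSecondOrder`) of a critic-PASSed DRAFT line; the rarity `p`, the
small-field mass `τ` and (i)/(ii) remain INPUTS; S5, U5, ⟨24004⟩ ⟨24335⟩ ⟨24336⟩ remain OPEN; no stub is closed by name, no crux, rung or summit is proved;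
**the Yang–Mills mass gap is NOT proved by this file.**
-/

set_option autoImplicit false

noncomputable section

open MeasureTheory
open Literature.Probability.LatticeModels (Site)
open Literature.MathematicalPhysics.QuantumFieldTheory.AxialGauge (boxEdges)
open Literature.MathematicalPhysics.QuantumLattice (LGConfig gaugeTransformZd fundamentalRep integrable_of_bound)
open Summit.QuantumFields.YangMills.Theorems.WeakCouplingRates (boxState boxCentre plaqCostAt boxPlaqCov measurable_plaqCostAt abs_plaqCostAt_le
  plaqCostAt_nonneg plaqCostAt_gaugeTransformZd secondCountableTopology_su2)

namespace Summit.QuantumFields.YangMills.Theorems.AllWindowsColdBoxBoxHighLine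

open FPRep

namespace BoxToChart

variable {H : ℕ}

/-! ## Elementary real lemmas -/

/-- The Step C ratio estimate: `0 ≤ a ≤ b`, `0 ≤ R, R' ≤ E ≤ τ b`, `0 ≤ τ` ⇒ `|(a+R)/(b+R') − a/b| ≤ 2τ`. -/
theorem ratio_le {a b R R' E τ : ℝ} (ha : 0 ≤ a) (hab : a ≤ b) (hR : 0 ≤ R) (hRE : R ≤ E) (hR' : 0 ≤ R') (hR'E : R' ≤ E)
    (hE : E ≤ τ * b) (hτ : 0 ≤ τ) : |(a + R) / (b + R') - a / b| ≤ 2 * τ := by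
  have hb : 0 ≤ b := ha.trans hab
  rcases hb.eq_or_lt with hb0 | hbpos
  · -- degenerate: everything vanishes
    have hE0 : E ≤ 0 := by rw [← hb0, mul_zero] at hE; exact hE
    have hR0 : R = 0 := le_antisymm (hRE.trans hE0) hR
    have hR'0 : R' = 0 := le_antisymm (hR'E.trans hE0) hR'
    have ha0 : a = 0 := le_antisymm (hab.trans hb0.symm.le) ha
    rw [hR0, hR'0, ha0, ← hb0]
    norm_num
    exact hτ
  · have hB : 0 < b + R' := by linarith
    have hkey : (a + R) / (b + R') - a / b = (R * b - a * R') / ((b + R') * b) := by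
      field_simp
      ring
    rw [hkey, abs_div, abs_of_pos (mul_pos hB hbpos), div_le_iff₀ (mul_pos hB hbpos)]
    have h1 : R * b ≤ τ * b * b := by nlinarith
    have h2 : a * R' ≤ τ * b * b := by nlinarith
    have h3 : |R * b - a * R'| ≤ τ * b * b := by
      rw [abs_le]; constructor <;> nlinarith [mul_nonneg hR hb, mul_nonneg ha hR']
    nlinarith [mul_nonneg hτ (mul_nonneg hb hR'), mul_nonneg hτ (mul_nonneg hb hb)]

/-- The covariance algebra: `|Eᵢ − Aᵢ| ≤ η` (`i = 1,2,3`), `0 ≤ E₂ ≤ 1`, `0 ≤ A₁ ≤ 1` ⇒ `|16(E₃ − E₁E₂) − 16(A₃ − A₁A₂)| ≤ 48η`. -/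
theorem cov_arith {E₁ E₂ E₃ A₁ A₂ A₃ η : ℝ} (h1 : |E₁ - A₁| ≤ η) (h2 : |E₂ - A₂| ≤ η) (h3 : |E₃ - A₃| ≤ η) (hE2 : 0 ≤ E₂) (hE2' : E₂ ≤ 1)
    (hA1 : 0 ≤ A₁) (hA1' : A₁ ≤ 1) : |16 * (E₃ - E₁ * E₂) - 16 * (A₃ - A₁ * A₂)| ≤ 48 * η := by
  have e : 16 * (E₃ - E₁ * E₂) - 16 * (A₃ - A₁ * A₂) = 16 * (E₃ - A₃) - 16 * ((E₁ - A₁) * E₂) - 16 * (A₁ * (E₂ - A₂)) := by ring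
  rw [e]
  have h16 : (0 : ℝ) < 16 := by norm_num
  have k1 : |(E₁ - A₁) * E₂| ≤ η := by
    rw [abs_mul, abs_of_nonneg hE2]
    calc |E₁ - A₁| * E₂ ≤ η * 1 := mul_le_mul h1 hE2' hE2 ((abs_nonneg _).trans h1)
      _ = η := mul_one η
  have k2 : |A₁ * (E₂ - A₂)| ≤ η := by
    rw [abs_mul, abs_of_nonneg hA1]
    calc A₁ * |E₂ - A₂| ≤ 1 * η := mul_le_mul hA1' h2 (abs_nonneg _) zero_le_one
      _ = η := one_mul η
  have a1 : |16 * (E₃ - A₃)| = 16 * |E₃ - A₃| := by rw [abs_mul, abs_of_pos h16]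
  have a2 : |16 * ((E₁ - A₁) * E₂)| = 16 * |(E₁ - A₁) * E₂| := by rw [abs_mul, abs_of_pos h16]
  have a3 : |16 * (A₁ * (E₂ - A₂))| = 16 * |A₁ * (E₂ - A₂)| := by rw [abs_mul, abs_of_pos h16]
  have htri : |16 * (E₃ - A₃) - 16 * ((E₁ - A₁) * E₂) - 16 * (A₁ * (E₂ - A₂))| ≤
      |16 * (E₃ - A₃)| + |16 * ((E₁ - A₁) * E₂)| + |16 * (A₁ * (E₂ - A₂))| :=
    (abs_sub _ _).trans (by linarith [abs_sub (16 * (E₃ - A₃)) (16 * ((E₁ - A₁) * E₂))])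
  linarith

/-! ## The FP chart weight through the Jacobian weight; nonnegativity of the action; finiteness of the chart domain -/

/-- `w_J(a) = h_J(U(a)) · e^{−β S(U(a))} · Π_e σ(‖a_e‖)` (definitional bookkeeping). -/
theorem fpChartWeight_eq_jacWeight_mul (β : ℝ) (H : ℕ) (r : ℝ) (a : LandauFree H → E3) :
    fpChartWeight β H r a = jacWeight β H r (edgeChart H a) * Real.exp (-(β * boxWilson H (edgeChart H a))) * chartHaarWeight H a := by
  simp only [fpChartWeight, jacWeight, fpWeight, mul_add, neg_add, Real.exp_add]
  ring

/-- The box Wilson action of an `SU(2)` configuration is non-negative. -/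
theorem boxWilson_nonneg (H : ℕ) (U : LGConfig 4 SU2) : 0 ≤ boxWilson H U := by
  unfold boxWilson Literature.MathematicalPhysics.QuantumLattice.wilsonBoundaryAction
  exact Finset.sum_nonneg fun p _ => plaqCostAt_nonneg p.1 p.2.1.1 p.2.1.2 U

/-- `e^{−βS} ≤ 1` for `β ≥ 0`. -/
theorem exp_neg_boxWilson_le_one {β : ℝ} (hβ : 0 ≤ β) (H : ℕ) (U : LGConfig 4 SU2) : Real.exp (-(β * boxWilson H U)) ≤ 1 :=
  Real.exp_le_one_iff.2 (by have := mul_nonneg hβ (boxWilson_nonneg H U); linarith)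

/-- The small-field box of radius `s < π` lies in the chart domain. -/
theorem smallField_subset_chartDomain {s : ℝ} (hs : s < Real.pi) : smallField H s ⊆ chartDomain H :=
  fun _ ha e => lt_of_le_of_lt (ha e) hs

/-- The chart domain has finite volume. -/
theorem volume_chartDomain_lt_top (H : ℕ) : volume (chartDomain H) < ⊤ :=
  lt_of_le_of_lt (measure_mono fun _ ha e => le_of_lt (ha e)) (SmallFieldFP.volume_smallField_lt_top (H := H) Real.pi_pos.le)

/-- `U ↦ e^{−β S(U)}` is measurable. -/
theorem measurable_exp_neg_boxWilson (β : ℝ) (H : ℕ) : Measurable fun U : LGConfig 4 SU2 => Real.exp (-(β * boxWilson H U)) := by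
  haveI := secondCountableTopology_su2
  have h := (EdgeChart.continuous_exp_boxWilson β H).measurable
  simpa only [neg_mul] using h

/-! ## Integrability of the chart integrands (bounded on a set of finite volume) -/

/-- The chart weight with the small-plaquette indicator, times a bounded measurable observable, is integrable on the chart domain. -/
theorem integrableOn_obs_mul_weight {β : ℝ} (hβ : 0 ≤ β) (r spl : ℝ) {G : LGConfig 4 SU2 → ℝ} (hGm : Measurable G) {B : ℝ}
    (hGB : ∀ U, |G U| ≤ B) :
    IntegrableOn (fun a : LandauFree H → E3 => G (edgeChart H a) * (jacWeight β H r (edgeChart H a) *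
      (spIndicator H spl (edgeChart H a) * (Real.exp (-(β * boxWilson H (edgeChart H a))) * chartHaarWeight H a)))) (chartDomain H) := by
  obtain ⟨C, -, hM⟩ := jacWeight_le hβ H r
  have hU := EdgeChart.measurable_edgeChart H
  refine Measure.integrableOn_of_bounded
    (M := B * (Real.exp (C * (interiorSites H).card * (1 + Real.log ((interiorSites H).card))) *
      (1 * (1 * (1 / (2 * Real.pi ^ 2)) ^ Fintype.card (LandauFree H)))))
    (volume_chartDomain_lt_top H).ne ?_ ?_
  · exact ((hGm.comp hU).mul (((measurable_jacWeight β H r).comp hU).mul (((measurable_spIndicator H spl).comp hU).mul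
      (((measurable_exp_neg_boxWilson β H).comp hU).mul (EdgeChart.measurable_chartHaarWeight H))))).aestronglyMeasurable
  · refine ae_of_all _ fun a => ?_
    have h0j := jacWeight_nonneg β H r (edgeChart H a)
    have hS := spIndicator_mem_Icc H spl (edgeChart H a)
    have he0 := (Real.exp_pos (-(β * boxWilson H (edgeChart H a)))).le
    have he1 := exp_neg_boxWilson_le_one hβ H (edgeChart H a)
    have hw0 := EdgeChart.chartHaarWeight_nonneg H a
    have hw1 := ChartHaar.chartHaarWeight_le (H := H) a
    rw [Real.norm_eq_abs, abs_mul, abs_of_nonneg (mul_nonneg h0j (mul_nonneg hS.1 (mul_nonneg he0 hw0)))]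
    have hB0 : 0 ≤ B := (abs_nonneg _).trans (hGB (edgeChart H a))
    have hM0 : 0 ≤ Real.exp (C * (interiorSites H).card * (1 + Real.log ((interiorSites H).card))) := (Real.exp_pos _).le
    have i1 : jacWeight β H r (edgeChart H a) * (spIndicator H spl (edgeChart H a) *
        (Real.exp (-(β * boxWilson H (edgeChart H a))) * chartHaarWeight H a)) ≤
        Real.exp (C * (interiorSites H).card * (1 + Real.log ((interiorSites H).card))) *
          (1 * (1 * (1 / (2 * Real.pi ^ 2)) ^ Fintype.card (LandauFree H))) :=
      mul_le_mul (hM _) (mul_le_mul hS.2 (mul_le_mul he1 hw1 hw0 zero_le_one) (mul_nonneg he0 hw0) zero_le_one)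
        (mul_nonneg hS.1 (mul_nonneg he0 hw0)) hM0
    exact mul_le_mul (hGB _) i1 (mul_nonneg h0j (mul_nonneg hS.1 (mul_nonneg he0 hw0))) hB0

/-- The chart weight times a bounded measurable observable is integrable on every set of finite volume. -/
theorem integrableOn_obs_mul_fpChartWeight {β : ℝ} (hβ : 0 ≤ β) (r : ℝ) {G : LGConfig 4 SU2 → ℝ} (hGm : Measurable G) {B : ℝ}
    (hGB : ∀ U, |G U| ≤ B) {S : Set (LandauFree H → E3)} (hS : volume S < ⊤) :
    IntegrableOn (fun a : LandauFree H → E3 => G (edgeChart H a) * fpChartWeight β H r a) S := by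
  obtain ⟨C, -, hM⟩ := jacWeight_le hβ H r
  have hU := EdgeChart.measurable_edgeChart H
  refine Measure.integrableOn_of_bounded
    (M := B * (Real.exp (C * (interiorSites H).card * (1 + Real.log ((interiorSites H).card))) * 1 *
      (1 / (2 * Real.pi ^ 2)) ^ Fintype.card (LandauFree H))) hS.ne ?_ ?_
  · exact ((hGm.comp hU).mul (FPChart.measurable_fpChartWeight β H r)).aestronglyMeasurable
  · refine ae_of_all _ fun a => ?_
    have hw0 := EdgeChart.chartHaarWeight_nonneg H a
    have hw1 := ChartHaar.chartHaarWeight_le (H := H) a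
    have he1 := exp_neg_boxWilson_le_one hβ H (edgeChart H a)
    rw [Real.norm_eq_abs, abs_mul, abs_of_nonneg (FPChart.fpChartWeight_nonneg β r a), fpChartWeight_eq_jacWeight_mul]
    have hB0 : 0 ≤ B := (abs_nonneg _).trans (hGB (edgeChart H a))
    have h0j := jacWeight_nonneg β H r (edgeChart H a)
    have he0 := (Real.exp_pos (-(β * boxWilson H (edgeChart H a)))).le
    have hM0 : 0 ≤ Real.exp (C * (interiorSites H).card * (1 + Real.log ((interiorSites H).card))) := (Real.exp_pos _).le
    have i1 : jacWeight β H r (edgeChart H a) * Real.exp (-(β * boxWilson H (edgeChart H a))) * chartHaarWeight H a ≤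
        Real.exp (C * (interiorSites H).card * (1 + Real.log ((interiorSites H).card))) * 1 *
          (1 / (2 * Real.pi ^ 2)) ^ Fintype.card (LandauFree H) :=
      mul_le_mul (mul_le_mul (hM _) he1 he0 hM0) hw1 hw0 (mul_nonneg hM0 zero_le_one)
    exact mul_le_mul (hGB _) i1 (mul_nonneg (mul_nonneg h0j he0) hw0) hB0

/-! ## Step B: the FP ratio in the chart -/

/-- The chart normaliser `∫_{chartDomain} e^{−βS(U(a))} Πσ(a) da` is positive. -/
theorem chartNormaliser_pos (β : ℝ) (H : ℕ) :
    0 < ∫ a in chartDomain H, Real.exp (-(β * boxWilson H (edgeChart H a))) * chartHaarWeight H a := by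
  haveI := EdgeChart.isProbabilityMeasure_boxHaar H
  have hint : Integrable (fun U : LGConfig 4 SU2 => Real.exp (-(β * boxWilson H U))) (EdgeChart.boxHaar H) := by
    simpa only [neg_mul] using EdgeChart.integrable_exp_boxWilson β H
  rw [← EdgeChart.integral_boxHaar_eq_chart H _ hint.aestronglyMeasurable]
  exact integral_exp_pos hint

/-- **Step B.**  For a bounded measurable observable `G`, the FP ratio of the box is the chart ratio with the weight
`W(a) = h_J(U a)·1_SP(U a)·e^{−βS(U a)}·Πσ(a)` (✓`boxStateEdgeChart`; the chart normaliser cancels). -/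
theorem boxState_ratio_eq_chart_ratio {β : ℝ} (hβ : 0 ≤ β) (r spl : ℝ) {G : LGConfig 4 SU2 → ℝ} (hGm : Measurable G) {B : ℝ}
    (hGB : ∀ U, |G U| ≤ B) :
    (∫ U, G U * (jacWeight β H r U * spIndicator H spl U) ∂(boxState (fundamentalRep (Fin 2)) β H)) /
        (∫ U, jacWeight β H r U * spIndicator H spl U ∂(boxState (fundamentalRep (Fin 2)) β H)) =
      (∫ a in chartDomain H, G (edgeChart H a) * (jacWeight β H r (edgeChart H a) *
          (spIndicator H spl (edgeChart H a) * (Real.exp (-(β * boxWilson H (edgeChart H a))) * chartHaarWeight H a)))) /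
        (∫ a in chartDomain H, jacWeight β H r (edgeChart H a) *
          (spIndicator H spl (edgeChart H a) * (Real.exp (-(β * boxWilson H (edgeChart H a))) * chartHaarWeight H a))) := by
  haveI := isProbabilityMeasure_boxState β H
  obtain ⟨C, -, hM⟩ := jacWeight_le hβ H r
  set M := Real.exp (C * (interiorSites H).card * (1 + Real.log ((interiorSites H).card))) with hMdef
  have hhS : ∀ U, |jacWeight β H r U * spIndicator H spl U| ≤ M := fun U => by
    have h0 := jacWeight_nonneg β H r U
    have hS := spIndicator_mem_Icc H spl U
    rw [abs_of_nonneg (mul_nonneg h0 hS.1)]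
    calc jacWeight β H r U * spIndicator H spl U ≤ M * 1 := mul_le_mul (hM U) hS.2 hS.1 (h0.trans (hM U))
      _ = M := mul_one M
  have hmhS : Measurable fun U => jacWeight β H r U * spIndicator H spl U := (measurable_jacWeight β H r).mul (measurable_spIndicator H spl)
  have hI1 : Integrable (fun U => G U * (jacWeight β H r U * spIndicator H spl U)) (boxState (fundamentalRep (Fin 2)) β H) := by
    refine integrable_of_bound (hGm.mul hmhS).aestronglyMeasurable (C := B * M) fun U => ?_
    rw [abs_mul]
    exact mul_le_mul (hGB U) (hhS U) (abs_nonneg _) ((abs_nonneg _).trans (hGB U))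
  have hI2 : Integrable (fun U => jacWeight β H r U * spIndicator H spl U) (boxState (fundamentalRep (Fin 2)) β H) :=
    integrable_of_bound hmhS.aestronglyMeasurable hhS
  rw [boxStateEdgeChart β H _ hI1, boxStateEdgeChart β H _ hI2, div_div_div_cancel_right₀ (chartNormaliser_pos β H).ne']
  simp only [mul_assoc]

/-! ## Step C: restriction to the small-field set -/

/-- On the chart, `h_J(U a)·1_SP(U a)·e^{−βS}·Πσ = w_J(a)·1_SP(U a)`. -/
theorem weight_eq_fpChartWeight_mul_spIndicator (β : ℝ) (H : ℕ) (r spl : ℝ) (a : LandauFree H → E3) :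
    jacWeight β H r (edgeChart H a) * (spIndicator H spl (edgeChart H a) * (Real.exp (-(β * boxWilson H (edgeChart H a))) *
      chartHaarWeight H a)) = fpChartWeight β H r a * spIndicator H spl (edgeChart H a) := by
  rw [fpChartWeight_eq_jacWeight_mul]; ring

/-- **Step C.**  For `0 ≤ G ≤ 1` measurable, `0 ≤ s ≤ 1/100`, `17s² ≤ spl²` (so `1_SP ∘ U = 1` on `D = smallField H s`) and
`∫_{chartDomain ∖ D} w_J ≤ τ·∫_{smallField(s/2)} w_J`, the chart ratio is within `2τ` of the `D`-ratio. -/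
theorem abs_chart_ratio_sub_smallField_ratio_le {β : ℝ} (hβ : 0 ≤ β) (r : ℝ) {spl s τ : ℝ} (hs0 : 0 ≤ s) (hs1 : s ≤ 1 / 100)
    (hspl : 17 * s ^ 2 ≤ spl ^ 2) (hτ0 : 0 ≤ τ)
    (hτ : ∫ a in chartDomain H \ smallField H s, fpChartWeight β H r a ≤ τ * ∫ a in smallField H (s / 2), fpChartWeight β H r a)
    {G : LGConfig 4 SU2 → ℝ} (hGm : Measurable G) (hG0 : ∀ U, 0 ≤ G U) (hG1 : ∀ U, G U ≤ 1) :
    |(∫ a in chartDomain H, G (edgeChart H a) * (jacWeight β H r (edgeChart H a) *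
          (spIndicator H spl (edgeChart H a) * (Real.exp (-(β * boxWilson H (edgeChart H a))) * chartHaarWeight H a)))) /
        (∫ a in chartDomain H, jacWeight β H r (edgeChart H a) *
          (spIndicator H spl (edgeChart H a) * (Real.exp (-(β * boxWilson H (edgeChart H a))) * chartHaarWeight H a))) -
      (∫ a in smallField H s, G (edgeChart H a) * fpChartWeight β H r a) / (∫ a in smallField H s, fpChartWeight β H r a)| ≤ 2 * τ := by
  have hGB : ∀ U, |G U| ≤ 1 := fun U => by rw [abs_of_nonneg (hG0 U)]; exact hG1 U
  have h1B : ∀ U : LGConfig 4 SU2, |(fun _ => (1 : ℝ)) U| ≤ 1 := fun U => by simp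
  have hsπ : s < Real.pi := by linarith [Real.pi_gt_three]
  have hDsub : smallField H s ⊆ chartDomain H := smallField_subset_chartDomain hsπ
  have hDm : MeasurableSet (smallField H s) := ChartGauss.measurableSet_smallField s
  have hDvol : volume (smallField H s) < ⊤ := SmallFieldFP.volume_smallField_lt_top hs0
  have hCvol := volume_chartDomain_lt_top H
  -- `1_SP ∘ U = 1` on `D`
  have hSP : ∀ a ∈ smallField H s, spIndicator H spl (edgeChart H a) = 1 := fun a ha =>
    spIndicator_of_mem (smallFieldSmallPlaquettes H s spl hs0 hs1 hspl a ha)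
  -- rewrite the weight
  simp only [weight_eq_fpChartWeight_mul_spIndicator]
  -- integrability
  have hIGW : IntegrableOn (fun a => G (edgeChart H a) * (fpChartWeight β H r a * spIndicator H spl (edgeChart H a))) (chartDomain H) := by
    have h := integrableOn_obs_mul_weight (H := H) hβ r spl hGm hGB
    simp only [weight_eq_fpChartWeight_mul_spIndicator] at h
    exact h
  have hIW : IntegrableOn (fun a => fpChartWeight β H r a * spIndicator H spl (edgeChart H a)) (chartDomain H) := by
    have h := integrableOn_obs_mul_weight (H := H) hβ r spl (measurable_const : Measurable fun _ : LGConfig 4 SU2 => (1 : ℝ)) h1B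
    simp only [weight_eq_fpChartWeight_mul_spIndicator, one_mul] at h
    exact h
  have hIGw : ∀ {S : Set (LandauFree H → E3)}, volume S < ⊤ → IntegrableOn (fun a => G (edgeChart H a) * fpChartWeight β H r a) S :=
    fun hS => integrableOn_obs_mul_fpChartWeight hβ r hGm hGB hS
  have hIw : ∀ {S : Set (LandauFree H → E3)}, volume S < ⊤ → IntegrableOn (fun a => fpChartWeight β H r a) S := fun hS => by
    have h := integrableOn_obs_mul_fpChartWeight (H := H) hβ r (measurable_const : Measurable fun _ : LGConfig 4 SU2 => (1 : ℝ)) h1B hS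
    simp only [one_mul] at h
    exact h
  -- the split `chartDomain = D ∪ (chartDomain ∖ D)`
  have hDG : ∫ a in smallField H s, G (edgeChart H a) * (fpChartWeight β H r a * spIndicator H spl (edgeChart H a)) =
      ∫ a in smallField H s, G (edgeChart H a) * fpChartWeight β H r a :=
    setIntegral_congr_fun hDm fun a ha => by simp only [hSP a ha, mul_one]
  have hD1 : ∫ a in smallField H s, fpChartWeight β H r a * spIndicator H spl (edgeChart H a) = ∫ a in smallField H s, fpChartWeight β H r a :=
    setIntegral_congr_fun hDm fun a ha => by simp only [hSP a ha, mul_one]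
  have hsplitG : ∫ a in chartDomain H, G (edgeChart H a) * (fpChartWeight β H r a * spIndicator H spl (edgeChart H a)) =
      (∫ a in smallField H s, G (edgeChart H a) * fpChartWeight β H r a) +
        ∫ a in chartDomain H \ smallField H s, G (edgeChart H a) * (fpChartWeight β H r a * spIndicator H spl (edgeChart H a)) := by
    rw [setIntegral_sdiff hDm hIGW hDsub, hDG]
    ring
  have hsplit1 : ∫ a in chartDomain H, fpChartWeight β H r a * spIndicator H spl (edgeChart H a) =
      (∫ a in smallField H s, fpChartWeight β H r a) +
        ∫ a in chartDomain H \ smallField H s, fpChartWeight β H r a * spIndicator H spl (edgeChart H a) := by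
    rw [setIntegral_sdiff hDm hIW hDsub, hD1]
    ring
  rw [hsplitG, hsplit1]
  -- sizes of the pieces
  have hDC : MeasurableSet (chartDomain H \ smallField H s) := SmallFieldFP.measurableSet_chartDomain.diff hDm
  have hw0 : ∀ a, 0 ≤ fpChartWeight β H r a := FPChart.fpChartWeight_nonneg β r
  have hS01 : ∀ a, 0 ≤ spIndicator H spl (edgeChart H a) ∧ spIndicator H spl (edgeChart H a) ≤ 1 := fun a => spIndicator_mem_Icc H spl _
  have hRG0 : 0 ≤ ∫ a in chartDomain H \ smallField H s, G (edgeChart H a) * (fpChartWeight β H r a * spIndicator H spl (edgeChart H a)) :=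
    setIntegral_nonneg hDC fun a _ => mul_nonneg (hG0 _) (mul_nonneg (hw0 a) (hS01 a).1)
  have hR10 : 0 ≤ ∫ a in chartDomain H \ smallField H s, fpChartWeight β H r a * spIndicator H spl (edgeChart H a) :=
    setIntegral_nonneg hDC fun a _ => mul_nonneg (hw0 a) (hS01 a).1
  have hCDvol : volume (chartDomain H \ smallField H s) < ⊤ := lt_of_le_of_lt (measure_mono Set.sdiff_subset) hCvol
  have hRGE : ∫ a in chartDomain H \ smallField H s, G (edgeChart H a) * (fpChartWeight β H r a * spIndicator H spl (edgeChart H a)) ≤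
      ∫ a in chartDomain H \ smallField H s, fpChartWeight β H r a := by
    refine setIntegral_mono_on (hIGW.mono_set Set.sdiff_subset) (hIw hCDvol) hDC fun a _ => ?_
    calc G (edgeChart H a) * (fpChartWeight β H r a * spIndicator H spl (edgeChart H a))
        ≤ 1 * (fpChartWeight β H r a * 1) := by
          refine mul_le_mul (hG1 _) (mul_le_mul_of_nonneg_left (hS01 a).2 (hw0 a)) (mul_nonneg (hw0 a) (hS01 a).1) zero_le_one
      _ = fpChartWeight β H r a := by ring
  have hR1E : ∫ a in chartDomain H \ smallField H s, fpChartWeight β H r a * spIndicator H spl (edgeChart H a) ≤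
      ∫ a in chartDomain H \ smallField H s, fpChartWeight β H r a := by
    refine setIntegral_mono_on (hIW.mono_set Set.sdiff_subset) (hIw hCDvol) hDC fun a _ => ?_
    calc fpChartWeight β H r a * spIndicator H spl (edgeChart H a) ≤ fpChartWeight β H r a * 1 :=
          mul_le_mul_of_nonneg_left (hS01 a).2 (hw0 a)
      _ = fpChartWeight β H r a := mul_one _
  have hhalf : ∫ a in smallField H (s / 2), fpChartWeight β H r a ≤ ∫ a in smallField H s, fpChartWeight β H r a :=
    setIntegral_mono_set (hIw hDvol) (ae_of_all _ hw0)
      (ae_of_all _ (fun a (ha : a ∈ smallField H (s / 2)) e => (ha e).trans (by linarith) : smallField H (s / 2) ⊆ smallField H s))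
  have hE : ∫ a in chartDomain H \ smallField H s, fpChartWeight β H r a ≤ τ * ∫ a in smallField H s, fpChartWeight β H r a :=
    hτ.trans (mul_le_mul_of_nonneg_left hhalf hτ0)
  have haD0 : 0 ≤ ∫ a in smallField H s, G (edgeChart H a) * fpChartWeight β H r a :=
    setIntegral_nonneg hDm fun a _ => mul_nonneg (hG0 _) (hw0 a)
  have hab : ∫ a in smallField H s, G (edgeChart H a) * fpChartWeight β H r a ≤ ∫ a in smallField H s, fpChartWeight β H r a := by
    refine setIntegral_mono_on (hIGw hDvol) (hIw hDvol) hDm fun a _ => ?_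
    calc G (edgeChart H a) * fpChartWeight β H r a ≤ 1 * fpChartWeight β H r a := mul_le_mul_of_nonneg_right (hG1 _) (hw0 a)
      _ = fpChartWeight β H r a := one_mul _
  exact ratio_le haD0 hab hRG0 hRGE hR10 hR1E hE hτ0

/-! ## Steps A + B + C per observable -/

/-- **A+B+C.**  For a gauge-invariant measurable `0 ≤ G ≤ 1`:
`|E_box G − ∫_D G(U a) w_J / ∫_D w_J| ≤ 4δ + 4·P_box(¬SP) + 2τ`. -/
theorem abs_boxState_sub_smallField_ratio_le (hH : 1 ≤ H) {β r r₀ spl s δ τ : ℝ} (hβ : 0 < β) (hδ0 : 0 ≤ δ) (hδ : δ ≤ 1 / 2)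
    (hrep : ∀ U : LGConfig 4 SU2, ColdWall H U → SmallPlaquettes H spl U →
        ∃ g : Site 4 → SU2, IsInteriorGauge H g ∧ InLandauGauge H (gaugeTransformZd g U) ∧
          ∀ e ∈ boxEdges 4 (2 * H + 1), linkDefect (gaugeTransformZd g U) e ≤ r₀ ^ 2)
    (hN : ∀ V : LGConfig 4 SU2, InLandauGauge H V → (∀ e ∈ boxEdges 4 (2 * H + 1), linkDefect V e ≤ r₀ ^ 2) →
        |orbitAverage H (jacWeight β H r) V / laplaceZ0 β H - 1| ≤ δ)
    (hs0 : 0 ≤ s) (hs1 : s ≤ 1 / 100) (hspl : 17 * s ^ 2 ≤ spl ^ 2) (hτ0 : 0 ≤ τ)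
    (hτ : ∫ a in chartDomain H \ smallField H s, fpChartWeight β H r a ≤ τ * ∫ a in smallField H (s / 2), fpChartWeight β H r a)
    {G : LGConfig 4 SU2 → ℝ} (hGinv : ∀ g : InteriorGauge H, ∀ U, G (gaugeTransformZd (extendGauge H g) U) = G U)
    (hGm : Measurable G) (hG0 : ∀ U, 0 ≤ G U) (hG1 : ∀ U, G U ≤ 1) :
    |(∫ U, G U ∂(boxState (fundamentalRep (Fin 2)) β H)) -
        (∫ a in smallField H s, G (edgeChart H a) * fpChartWeight β H r a) / (∫ a in smallField H s, fpChartWeight β H r a)| ≤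
      4 * δ + 4 * ((boxState (fundamentalRep (Fin 2)) β H) {U | ¬ SmallPlaquettes H spl U}).toReal + 2 * τ := by
  have hA := fpRepresentation H β r r₀ spl δ hH hβ hδ0 hδ hrep hN G hGinv hGm hG0 hG1
  have hGB : ∀ U, |G U| ≤ 1 := fun U => by rw [abs_of_nonneg (hG0 U)]; exact hG1 U
  rw [boxState_ratio_eq_chart_ratio hβ.le r spl hGm hGB] at hA
  have hC := abs_chart_ratio_sub_smallField_ratio_le (H := H) hβ.le r hs0 hs1 hspl hτ0 hτ hGm hG0 hG1
  calc _ ≤ _ + _ := abs_sub_le _ _ _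
    _ ≤ _ := add_le_add hA hC

end BoxToChart

end Summit.QuantumFields.YangMills.Theorems.AllWindowsColdBoxBoxHighLine

end
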